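import Literature.AlgebraicGeometry.Frobenioids.ModelFrobenioidRationallyStandard
import Literature.AlgebraicGeometry.Frobenioids.ModelFrobenioidBiratNormalized
import Literature.AlgebraicGeometry.Frobenioids.ModelFrobenioidIsFrobenioid
import Literature.AlgebraicGeometry.Frobenioids.BiratLocalization
import HarnessLib

/-!
# Frobenioids I, Theorem 5.2 (iii), second sentence — PROOF at THE birationalization

Mochizuki, *The geometry of Frobenioids I: the general theory*, Kyushu J. Math. **62** (2008)
293–400, §5, Theorem 5.2 (iii), kurims text p. 101, proof p. 103
[cite: MochizukiFrdI2008, Thm. 5.2(iii) p.101]: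

  "`C` is of rationally standard type if and only if the following conditions are satisfied:
  (a) `C` is of rational and standard type; (b) `(C^un-tr)^birat` admits a Frobenius-compact
  object."

`ModelFrobenioidRationallyStandard.lean` (seat abc-iut-L1-t2) proves the closed statement
`ModelFrobenioid.RationallyStandardTypeIff' Φ B DivB R` CONDITIONALLY on the p. 103 claim "every object
of `C` is birationally Frobenius-normalized" for the birationalization datum `R.B`
(`rationallyStandardTypeIff'_of_biratFrobeniusNormalized`).  `ModelFrobenioidBiratNormalized.lean`
(seat abc-iut-L1-d10) proves that claim for THE birationalization `C → C^birat` of Prop. 4.4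
(`PreFrobenioid.biratData hF hsq`, seats abc-iut-L6-t6/L6-t8):
`ModelFrobenioid.isOfBiratFrobeniusNormalizedType_of_isDivisorial`.  This file composes the two: the
second sentence of Thm. 5.2 (iii) holds UNCONDITIONALLY for every parameter `R` whose birationalization
datum is THE birationalization (`rationallyStandardTypeIff'_biratData`), and — discharging also the
inputs `hF` ("`C` is a Frobenioid", Thm. 5.2 (ii), seat abc-iut-found's `ModelFrobenioid.isFrobenioid`)
and `hsq` (Prop. 1.11 (vii), `PreFrobenioid.hasBiratSquares_of_isFrobenioid`) from the standing
hypotheses of Thm. 5.2 — with no input beyond print's standing hypotheses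
(`rationallyStandardTypeIff'_biratData_of_hypotheses`).  The remaining parameters `R.Supp`, `R.SU`,
`R.BU` (support predicate, operations and birationalization of `C^un-tr`) enter both sides of the `iff`
symmetrically and are unconstrained, exactly as in Def. 4.5 (iii) (seat abc-iut-L1-t3).
-/

namespace Literature.AlgebraicGeometry.Frobenioids

open CategoryTheory Opposite

universe w v u

namespace ModelFrobenioid

variable {D : Type u} [Category.{v} D] (Φ B : Dᵒᵖ ⥤ CommMonCat.{w}) (DivB : B ⟶ monoidGp Φ)

/-- The standing hypotheses of Thm. 5.2 make the model Frobenioid `C → F_Φ` a Frobenioid (Thm. 5.2 (ii),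
seat abc-iut-found). [cite: MochizukiFrdI2008, Thm. 5.2(ii) p.101] -/
theorem Hypotheses.isFrobenioid (h : Hypotheses Φ B) :
    PreFrobenioid.IsFrobenioid (toElem Φ B DivB) :=
  ModelFrobenioid.isFrobenioid h.isMonoidOn h.isDivisorial h.isMonoidOn_rat h.isGroupLike_rat
    h.isGraphConnected h.isTotallyEpimorphic

/-- Under the standing hypotheses of Thm. 5.2 the model Frobenioid has the square-completion property
of Prop. 1.11 (vii) used to form `C^birat`. [cite: MochizukiFrdI2008, Prop. 1.11(vii) p.37] -/
theorem Hypotheses.hasBiratSquares (h : Hypotheses Φ B) :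
    PreFrobenioid.HasBiratSquares (toElem Φ B DivB) :=
  PreFrobenioid.hasBiratSquares_of_isFrobenioid (h.isFrobenioid Φ B DivB)

/-- **Thm. 5.2 (iii), second sentence, at THE birationalization** (unconditional): for every parameter
`R` of Def. 4.5 (iii) whose birationalization datum `R.B` is THE birationalization `C → C^birat` of
Prop. 4.4 (`PreFrobenioid.biratData hF hsq`), "`C` is of rationally standard type if and only if (a) `C`
is of rational and standard type and (b) `(C^un-tr)^birat` admits a Frobenius-compact object" — the
p. 103 claim "every object of `C` is birationally Frobenius-normalized" being seat abc-iut-L1-d10's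
`isOfBiratFrobeniusNormalizedType_of_isDivisorial`. [cite: MochizukiFrdI2008, Thm. 5.2(iii) p.103] -/
theorem rationallyStandardTypeIff'_biratData
    (hF : PreFrobenioid.IsFrobenioid (toElem Φ B DivB))
    (hsq : PreFrobenioid.HasBiratSquares (toElem Φ B DivB))
    (R : (data Φ B DivB).RSParams) (hRB : R.B = PreFrobenioid.biratData hF hsq) :
    RationallyStandardTypeIff' Φ B DivB R := by
  intro h
  refine rationallyStandardTypeIff'_of_biratFrobeniusNormalized Φ B DivB R ?_ h
  rw [hRB]
  exact isOfBiratFrobeniusNormalizedType_of_isDivisorial hF hsq h.isDivisorial h.isGroupLike_rat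

/-- **Thm. 5.2 (iii), second sentence**, with THE birationalization formed from the standing hypotheses
`h` of Thm. 5.2 alone (`Φ` divisorial on a connected, totally epimorphic `D`, `B` group-like): for every
`R` with `R.B = C^birat`, the printed `iff` holds. [cite: MochizukiFrdI2008, Thm. 5.2(iii) p.103] -/
theorem rationallyStandardTypeIff'_biratData_of_hypotheses (h : Hypotheses Φ B)
    (R : (data Φ B DivB).RSParams)
    (hRB : R.B = PreFrobenioid.biratData (h.isFrobenioid Φ B DivB) (h.hasBiratSquares Φ B DivB)) :
    RationallyStandardTypeIff' Φ B DivB R :=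
  rationallyStandardTypeIff'_biratData Φ B DivB _ _ R hRB

/-- The `iff` itself (the conclusion of `RationallyStandardTypeIff'` with its hypothesis discharged) at
THE birationalization: "`C` is of rationally standard type ⟺ (a) rational and standard type ∧ (b)
`(C^un-tr)^birat` admits a Frobenius-compact object". [cite: MochizukiFrdI2008, Thm. 5.2(iii) p.103] -/
theorem isOfRationallyStandardType_iff_biratData (h : Hypotheses Φ B)
    (R : (data Φ B DivB).RSParams)
    (hRB : R.B = PreFrobenioid.biratData (h.isFrobenioid Φ B DivB) (h.hasBiratSquares Φ B DivB)) :
    (data Φ B DivB).IsOfRationallyStandardType R ↔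
      ((∀ A : ModelFrobenioid Φ B DivB, PreFrobenioidData.IsRational R.B R.Supp A) ∧
          (data Φ B DivB).IsOfStandardType) ∧
        ∃ Y : R.BU.Birat, R.BU.ops.IsFrobeniusCompact Y :=
  rationallyStandardTypeIff'_biratData_of_hypotheses Φ B DivB h R hRB h

end ModelFrobenioid

end Literature.AlgebraicGeometry.Frobenioids
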